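import Literature.Geometry.Lorentzian.TameGenericity
import HarnessLib

/-!
# Tame genericity: restriction of tame families along parameter maps, and the composition of
# tame Christodoulou genericities along curves

`TameGenericity.lean` is a definitions file (tame families `InitialDataSet.IsTameDataFamily`,
immersion at the base point `InitialDataSet.IsImmersedAtZero`, tame Christodoulou genericity
`InitialDataSet.IsTameChristodoulouGeneric`); this file adds no definition and proves the
bookkeeping that assemblies over the tame notion need:

* `InitialDataSet.IsSmoothDataFamily.comp_contDiff` — restricting a jointly smooth `m`-parameter
  family along a smooth map of parameter spaces `φ : ℝᵐ' → ℝᵐ` gives a jointly smooth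
  `m'`-parameter family;
* `InitialDataSet.IsTameDataFamily.comp_contDiff` — the same for TAME families on an end `e`,
  provided `φ 0 = 0` (so that `wDist`-continuity at the base parameter composes); in particular
  the diagonal `c ↦ G (c, c)` of a tame two-parameter family is a tame curve on the same end;
* `InitialDataSet.IsTameChristodoulouGeneric.mono` — tame genericity is monotone under pointwise
  implication on the admissible class (same witness family);
* `InitialDataSet.isTameChristodoulouGeneric_of_relative` — **composition along curves**: if every
  datum of `𝓓` has a sole, strongly asymptotically flat end (so that constant curves are tame,
  `isTameDataFamily_const`), `Q` is tame-generic in `𝓓` (codimension `1`), and through the base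
  point of every tame curve of `𝓓`-data whose members off `0` satisfy `Q` — the curve being either
  immersed at `0` and injective, or constant — there passes a tame, injective, immersed curve of
  `𝓓`-data on the SAME end whose members off `0` satisfy `P`, then `P` is tame-generic in `𝓓`.
  Proof: through an exceptional datum `d` pass either the constant curve (if `Q d`) or the curve
  that `Q`'s genericity provides (if `¬ Q d`), and take the curve handed back. This is how a
  generic HYPOTHESIS `Q` (e.g. weak cosmic censorship in Christodoulou's formulation) enters the
  proof of a generic CONCLUSION `P`: Christodoulou genericity is not closed under conjunction, so
  `P` must be produced along `Q`-curves, not pointwise.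

Sources. D. Christodoulou, CQG **16** (1999) A23, p. A24 and Ann. Math. **149** (1999) 183,
p. 187 (genericity as positive codimension in a fixed space `𝓐`, lines `α₀ + c f`; two-parameter
families `α₀ + λ₁ f₁ + λ₂ f₂`); M. Dafermos, I. Rodnianski, arXiv:0811.0354, App. B.2.3 (the
weighted class). The statements here are folklore bookkeeping over the tree's rendering
`TameGenericity.lean`; nothing analytic is claimed.

Not here: any construction of curves of initial data (gluing, conformal method), any statement
about developments.
-/

open Manifold Bundle TopologicalSpace Filter Function
open scoped ContDiff Topology ENNReal

noncomputable section

namespace Literature.Geometry.Lorentzian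

namespace InitialDataSet

section Smooth

variable {E : Type*} [NormedAddCommGroup E] [NormedSpace ℝ E] {H : Type*} [TopologicalSpace H]
  {I : ModelWithCorners ℝ E H} {X : Type*} [TopologicalSpace X] [ChartedSpace H X]
  [IsManifold I ∞ X]

/-- **Restricting a jointly smooth `m`-parameter family of initial data along a smooth map of
parameter spaces `φ : ℝᵐ' → ℝᵐ` gives a jointly smooth `m'`-parameter family** (both component
maps are composed with the smooth map `(c, x) ↦ (φ c, x)`). [folklore] -/
theorem IsSmoothDataFamily.comp_contDiff {m m' : ℕ}
    {G : EuclideanSpace ℝ (Fin m) → InitialDataSet I X} (hG : IsSmoothDataFamily m G)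
    {φ : EuclideanSpace ℝ (Fin m') → EuclideanSpace ℝ (Fin m)} (hφ : ContDiff ℝ ∞ φ) :
    IsSmoothDataFamily m' (fun c ↦ G (φ c)) := by
  have hL : ContMDiff (𝓘(ℝ, EuclideanSpace ℝ (Fin m')).prod I)
      (𝓘(ℝ, EuclideanSpace ℝ (Fin m)).prod I) ∞
      (fun p : EuclideanSpace ℝ (Fin m') × X ↦ (φ p.1, p.2)) :=
    (hφ.contMDiff.comp contMDiff_fst).prodMk contMDiff_snd
  exact ⟨hG.1.comp hL, hG.2.comp hL⟩

end Smooth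

variable {X : Type*} [TopologicalSpace X] [ChartedSpace E3 X] [IsManifold (𝓡 3) ∞ X]

/-- **Restricting a TAME family along a smooth parameter map fixing the origin gives a tame family
on the same end**: joint smoothness composes (`IsSmoothDataFamily.comp_contDiff`), the end and the
Dafermos–Rodnianski asymptotics are those of the members, the mass `c ↦ M(φ c)` is continuous, and
`wDist`-continuity at `0` composes with `φ 0 = 0`. In particular the diagonal `c ↦ G (c, c)` and the
axes of a tame two-parameter family are tame curves (Christodoulou's `α₀ + λ₁ f₁ + λ₂ f₂`,
Ann. Math. 149 (1999), p. 187, restricted to a line through the origin of the parameter plane).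
[folklore] -/
theorem IsTameDataFamily.comp_contDiff {e : AFEnd X} {m m' : ℕ}
    {G : EuclideanSpace ℝ (Fin m) → InitialDataSet (𝓡 3) X} (hG : IsTameDataFamily e m G)
    {φ : EuclideanSpace ℝ (Fin m') → EuclideanSpace ℝ (Fin m)} (hφ : ContDiff ℝ ∞ φ)
    (h0 : φ 0 = 0) : IsTameDataFamily e m' (fun c ↦ G (φ c)) := by
  obtain ⟨hs, hsole, ⟨M, hM, hSAF⟩, hlim⟩ := hG
  refine ⟨hs.comp_contDiff hφ, hsole, ⟨fun c ↦ M (φ c), hM.comp hφ.continuous, fun c ↦ hSAF _⟩,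
    ?_⟩
  have hd : Tendsto φ (𝓝 0) (𝓝 0) := by
    simpa only [h0] using hφ.continuous.tendsto 0
  show Tendsto (fun c ↦ e.wDist (G (φ c)) (G (φ 0))) (𝓝 0) (𝓝 0)
  rw [h0]
  exact hlim.comp hd

/-- **Tame Christodoulou genericity is monotone under pointwise implication on the admissible
class**: if `P → Q` on `𝓓` then the exceptional set of `Q` lies in that of `P`, and the same tame
witness families serve. [folklore] -/
theorem IsTameChristodoulouGeneric.mono {𝓓 : Set (InitialDataSet (𝓡 3) X)}
    {P Q : InitialDataSet (𝓡 3) X → Prop} {m : ℕ} (h : IsTameChristodoulouGeneric 𝓓 P m)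
    (hPQ : ∀ d ∈ 𝓓, P d → Q d) : IsTameChristodoulouGeneric 𝓓 Q m := by
  intro d hd
  obtain ⟨e, F, hF, himm, h0, hinj, hD, hE⟩ := h d ⟨hd.1, fun hP ↦ hd.2 (hPQ d hd.1 hP)⟩
  exact ⟨e, F, hF, himm, h0, hinj, hD,
    fun c hc hmem ↦ hE c hc ⟨hmem.1, fun hP ↦ hmem.2 (hPQ _ hmem.1 hP)⟩⟩

/-- **Composition of tame Christodoulou genericities along curves.** Let every datum of the class
`𝓓` have a sole, strongly asymptotically flat end (so constant curves are tame), let `Q` be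
tame-generic in `𝓓` with codimension `1`, and suppose: for every end `e` and every tame curve `F`
of `𝓓`-data on `e` whose members off `0` satisfy `Q` — `F` being either immersed at `0` and
injective, or constant (the base datum `F 0` is NOT assumed to satisfy `Q`) — there is a tame curve
`F'` of `𝓓`-data on the same end through the same base datum, `F' 0 = F 0`, injective and immersed
at `0`, whose members off `0` satisfy `P`. Then `P` is tame-generic in `𝓓` with codimension `1`.
Through an exceptional datum `d` one passes the constant curve (if `Q d`) or the witness curve of
`Q`'s genericity (if `¬ Q d`) and takes the curve handed back. The door through which a generic
hypothesis (Christodoulou's weak cosmic censorship, CQG 16 (1999), p. A24) enters the proof of a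
generic conclusion: genericity is produced along `Q`-curves, never by conjunction. [folklore] -/
theorem isTameChristodoulouGeneric_of_relative {𝓓 : Set (InitialDataSet (𝓡 3) X)}
    {Q P : InitialDataSet (𝓡 3) X → Prop}
    (h𝓓 : ∀ d ∈ 𝓓, ∃ e : AFEnd X, e.IsSoleEnd ∧ ∃ M : ℝ, e.IsStronglyAsymptoticallyFlatDR d M)
    (hQ : IsTameChristodoulouGeneric 𝓓 Q 1)
    (hrel : ∀ (e : AFEnd X) (F : EuclideanSpace ℝ (Fin 1) → InitialDataSet (𝓡 3) X),
      IsTameDataFamily e 1 F → ((IsImmersedAtZero 1 F ∧ Injective F) ∨ ∀ c, F c = F 0) →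
        (∀ c, F c ∈ 𝓓) → (∀ c ≠ 0, Q (F c)) →
          ∃ F' : EuclideanSpace ℝ (Fin 1) → InitialDataSet (𝓡 3) X,
            IsTameDataFamily e 1 F' ∧ F' 0 = F 0 ∧ Injective F' ∧ IsImmersedAtZero 1 F' ∧
              (∀ c, F' c ∈ 𝓓) ∧ ∀ c ≠ 0, P (F' c)) :
    IsTameChristodoulouGeneric 𝓓 P 1 := by
  intro d hd
  obtain ⟨hd𝓓, hdP⟩ := hd
  -- the tame base curve through `d`: constant if `Q d`, the `Q`-witness otherwise
  have base : ∃ (e : AFEnd X) (F : EuclideanSpace ℝ (Fin 1) → InitialDataSet (𝓡 3) X),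
      IsTameDataFamily e 1 F ∧ ((IsImmersedAtZero 1 F ∧ Injective F) ∨ ∀ c, F c = F 0) ∧
        F 0 = d ∧ (∀ c, F c ∈ 𝓓) ∧ ∀ c ≠ 0, Q (F c) := by
    by_cases hQd : Q d
    · obtain ⟨e, hsole, M, hSAF⟩ := h𝓓 d hd𝓓
      exact ⟨e, fun _ ↦ d, isTameDataFamily_const hsole 1 hSAF, Or.inr fun _ ↦ rfl, rfl,
        fun _ ↦ hd𝓓, fun _ _ ↦ hQd⟩
    · obtain ⟨e, F, hF, himmF, h0, hinjF, h𝓓F, hE⟩ := hQ d ⟨hd𝓓, hQd⟩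
      refine ⟨e, F, hF, Or.inl ⟨himmF, hinjF⟩, h0, h𝓓F, fun c hc ↦ ?_⟩
      by_contra hQc
      exact hE c hc ⟨h𝓓F c, hQc⟩
  obtain ⟨e, F, hF, hFdich, hF0, hF𝓓, hFQ⟩ := base
  obtain ⟨F', hF', hF'0, hinj, himm, hF'𝓓, hP⟩ := hrel e F hF hFdich hF𝓓 hFQ
  exact ⟨e, F', hF', himm, hF'0.trans hF0, hinj, hF'𝓓, fun c hc hmem ↦ hmem.2 (hP c hc)⟩

/-- **Composition of tame Christodoulou genericities along curves, the end re-chosen.** As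
`isTameChristodoulouGeneric_of_relative`, but the curve handed back may be tame on ANOTHER
asymptotically flat end `e'` of `X` (another chart or collar of the same end, `X` having one end in
practice): tame genericity only asks for SOME end per exceptional datum, so the composition goes
through verbatim with `e'` in place of `e`. This is the form an engine wants — it may re-centre or
shrink the chart in which the weighted distance `AFEnd.wDist` of its witness curve is measured.
[folklore] -/
theorem isTameChristodoulouGeneric_of_relative' {𝓓 : Set (InitialDataSet (𝓡 3) X)}
    {Q P : InitialDataSet (𝓡 3) X → Prop}
    (h𝓓 : ∀ d ∈ 𝓓, ∃ e : AFEnd X, e.IsSoleEnd ∧ ∃ M : ℝ, e.IsStronglyAsymptoticallyFlatDR d M)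
    (hQ : IsTameChristodoulouGeneric 𝓓 Q 1)
    (hrel : ∀ (e : AFEnd X) (F : EuclideanSpace ℝ (Fin 1) → InitialDataSet (𝓡 3) X),
      IsTameDataFamily e 1 F → ((IsImmersedAtZero 1 F ∧ Injective F) ∨ ∀ c, F c = F 0) →
        (∀ c, F c ∈ 𝓓) → (∀ c ≠ 0, Q (F c)) →
          ∃ (e' : AFEnd X) (F' : EuclideanSpace ℝ (Fin 1) → InitialDataSet (𝓡 3) X),
            IsTameDataFamily e' 1 F' ∧ F' 0 = F 0 ∧ Injective F' ∧ IsImmersedAtZero 1 F' ∧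
              (∀ c, F' c ∈ 𝓓) ∧ ∀ c ≠ 0, P (F' c)) :
    IsTameChristodoulouGeneric 𝓓 P 1 := by
  intro d hd
  obtain ⟨hd𝓓, hdP⟩ := hd
  -- the tame base curve through `d`: constant if `Q d`, the `Q`-witness otherwise
  have base : ∃ (e : AFEnd X) (F : EuclideanSpace ℝ (Fin 1) → InitialDataSet (𝓡 3) X),
      IsTameDataFamily e 1 F ∧ ((IsImmersedAtZero 1 F ∧ Injective F) ∨ ∀ c, F c = F 0) ∧
        F 0 = d ∧ (∀ c, F c ∈ 𝓓) ∧ ∀ c ≠ 0, Q (F c) := by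
    by_cases hQd : Q d
    · obtain ⟨e, hsole, M, hSAF⟩ := h𝓓 d hd𝓓
      exact ⟨e, fun _ ↦ d, isTameDataFamily_const hsole 1 hSAF, Or.inr fun _ ↦ rfl, rfl,
        fun _ ↦ hd𝓓, fun _ _ ↦ hQd⟩
    · obtain ⟨e, F, hF, himmF, h0, hinjF, h𝓓F, hE⟩ := hQ d ⟨hd𝓓, hQd⟩
      refine ⟨e, F, hF, Or.inl ⟨himmF, hinjF⟩, h0, h𝓓F, fun c hc ↦ ?_⟩
      by_contra hQc
      exact hE c hc ⟨h𝓓F c, hQc⟩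
  obtain ⟨e, F, hF, hFdich, hF0, hF𝓓, hFQ⟩ := base
  obtain ⟨e', F', hF', hF'0, hinj, himm, hF'𝓓, hP⟩ := hrel e F hF hFdich hF𝓓 hFQ
  exact ⟨e', F', hF', himm, hF'0.trans hF0, hinj, hF'𝓓, fun c hc hmem ↦ hmem.2 (hP c hc)⟩

/-- A same-end curve witness is in particular an any-end curve witness: the hypothesis of
`isTameChristodoulouGeneric_of_relative` implies that of `isTameChristodoulouGeneric_of_relative'`.
[folklore] -/
theorem exists_end_of_sameEnd_witness {𝓓 : Set (InitialDataSet (𝓡 3) X)}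
    {Q P : InitialDataSet (𝓡 3) X → Prop}
    (hrel : ∀ (e : AFEnd X) (F : EuclideanSpace ℝ (Fin 1) → InitialDataSet (𝓡 3) X),
      IsTameDataFamily e 1 F → ((IsImmersedAtZero 1 F ∧ Injective F) ∨ ∀ c, F c = F 0) →
        (∀ c, F c ∈ 𝓓) → (∀ c ≠ 0, Q (F c)) →
          ∃ F' : EuclideanSpace ℝ (Fin 1) → InitialDataSet (𝓡 3) X,
            IsTameDataFamily e 1 F' ∧ F' 0 = F 0 ∧ Injective F' ∧ IsImmersedAtZero 1 F' ∧
              (∀ c, F' c ∈ 𝓓) ∧ ∀ c ≠ 0, P (F' c))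
    (e : AFEnd X) (F : EuclideanSpace ℝ (Fin 1) → InitialDataSet (𝓡 3) X)
    (hF : IsTameDataFamily e 1 F) (hdich : (IsImmersedAtZero 1 F ∧ Injective F) ∨ ∀ c, F c = F 0)
    (h𝓓 : ∀ c, F c ∈ 𝓓) (hQ : ∀ c ≠ 0, Q (F c)) :
    ∃ (e' : AFEnd X) (F' : EuclideanSpace ℝ (Fin 1) → InitialDataSet (𝓡 3) X),
      IsTameDataFamily e' 1 F' ∧ F' 0 = F 0 ∧ Injective F' ∧ IsImmersedAtZero 1 F' ∧
        (∀ c, F' c ∈ 𝓓) ∧ ∀ c ≠ 0, P (F' c) := by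
  obtain ⟨F', h⟩ := hrel e F hF hdich h𝓓 hQ
  exact ⟨e, F', h⟩

/-- **Composition of tame Christodoulou genericities along curves, the hand-back asked only at
exceptional base data.** As `isTameChristodoulouGeneric_of_relative'`, but the hypothesis producing
a `P`-curve (on some end) along a `Q`-curve `F` is only required when the base datum `F 0` is
EXCEPTIONAL for `P` (`¬ P (F 0)`): the composition only ever invokes it through an exceptional
datum — through a datum that already satisfies `P` nothing needs to pass. This is the sharp form
of the door through which a generic hypothesis `Q` enters a generic conclusion `P`: the relative
hypothesis so weakened is implied by tame genericity of `P` itself (`…_of_isTameChristodoulouGeneric`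
below), so that, given `Q` generic, `P` generic is EQUIVALENT to it. Christodoulou, CQG 16 (1999)
A23, p. A24 (genericity as positive codimension in a fixed space; curves `α₀ + c f`). [folklore] -/
theorem isTameChristodoulouGeneric_of_relative_exceptional {𝓓 : Set (InitialDataSet (𝓡 3) X)}
    {Q P : InitialDataSet (𝓡 3) X → Prop}
    (h𝓓 : ∀ d ∈ 𝓓, ∃ e : AFEnd X, e.IsSoleEnd ∧ ∃ M : ℝ, e.IsStronglyAsymptoticallyFlatDR d M)
    (hQ : IsTameChristodoulouGeneric 𝓓 Q 1)
    (hrel : ∀ (e : AFEnd X) (F : EuclideanSpace ℝ (Fin 1) → InitialDataSet (𝓡 3) X),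
      IsTameDataFamily e 1 F → ((IsImmersedAtZero 1 F ∧ Injective F) ∨ ∀ c, F c = F 0) →
        (∀ c, F c ∈ 𝓓) → (∀ c ≠ 0, Q (F c)) → ¬ P (F 0) →
          ∃ (e' : AFEnd X) (F' : EuclideanSpace ℝ (Fin 1) → InitialDataSet (𝓡 3) X),
            IsTameDataFamily e' 1 F' ∧ F' 0 = F 0 ∧ Injective F' ∧ IsImmersedAtZero 1 F' ∧
              (∀ c, F' c ∈ 𝓓) ∧ ∀ c ≠ 0, P (F' c)) :
    IsTameChristodoulouGeneric 𝓓 P 1 := by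
  intro d hd
  obtain ⟨hd𝓓, hdP⟩ := hd
  -- the tame base curve through `d`: constant if `Q d`, the `Q`-witness otherwise
  have base : ∃ (e : AFEnd X) (F : EuclideanSpace ℝ (Fin 1) → InitialDataSet (𝓡 3) X),
      IsTameDataFamily e 1 F ∧ ((IsImmersedAtZero 1 F ∧ Injective F) ∨ ∀ c, F c = F 0) ∧
        F 0 = d ∧ (∀ c, F c ∈ 𝓓) ∧ ∀ c ≠ 0, Q (F c) := by
    by_cases hQd : Q d
    · obtain ⟨e, hsole, M, hSAF⟩ := h𝓓 d hd𝓓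
      exact ⟨e, fun _ ↦ d, isTameDataFamily_const hsole 1 hSAF, Or.inr fun _ ↦ rfl, rfl,
        fun _ ↦ hd𝓓, fun _ _ ↦ hQd⟩
    · obtain ⟨e, F, hF, himmF, h0, hinjF, h𝓓F, hE⟩ := hQ d ⟨hd𝓓, hQd⟩
      refine ⟨e, F, hF, Or.inl ⟨himmF, hinjF⟩, h0, h𝓓F, fun c hc ↦ ?_⟩
      by_contra hQc
      exact hE c hc ⟨h𝓓F c, hQc⟩
  obtain ⟨e, F, hF, hFdich, hF0, hF𝓓, hFQ⟩ := base
  obtain ⟨e', F', hF', hF'0, hinj, himm, hF'𝓓, hP⟩ := hrel e F hF hFdich hF𝓓 hFQ (hF0 ▸ hdP)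
  exact ⟨e', F', hF', himm, hF'0.trans hF0, hinj, hF'𝓓, fun c hc hmem ↦ hmem.2 (hP c hc)⟩

/-- **Tame genericity of `P` supplies the exceptional-base hand-back along ANY curves.** If `P` is
tame-generic in `𝓓` (codimension `1`), then through the base datum of every curve of `𝓓`-data whose
base datum is exceptional for `P` passes a tame, injective, immersed curve of `𝓓`-data (on some
end) whose members off `0` satisfy `P` — whatever the incoming curve and whatever `Q` its members
satisfy: the hand-back hypothesis of `isTameChristodoulouGeneric_of_relative_exceptional` is
NECESSARY for its conclusion (it is tame genericity of `P` read at the base datum). [folklore] -/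
theorem exists_curve_of_isTameChristodoulouGeneric_of_not {𝓓 : Set (InitialDataSet (𝓡 3) X)}
    {Q P : InitialDataSet (𝓡 3) X → Prop} (hP : IsTameChristodoulouGeneric 𝓓 P 1)
    (e : AFEnd X) (F : EuclideanSpace ℝ (Fin 1) → InitialDataSet (𝓡 3) X)
    (_hF : IsTameDataFamily e 1 F) (_hdich : (IsImmersedAtZero 1 F ∧ Injective F) ∨ ∀ c, F c = F 0)
    (h𝓓 : ∀ c, F c ∈ 𝓓) (_hQ : ∀ c ≠ 0, Q (F c)) (hexc : ¬ P (F 0)) :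
    ∃ (e' : AFEnd X) (F' : EuclideanSpace ℝ (Fin 1) → InitialDataSet (𝓡 3) X),
      IsTameDataFamily e' 1 F' ∧ F' 0 = F 0 ∧ Injective F' ∧ IsImmersedAtZero 1 F' ∧
        (∀ c, F' c ∈ 𝓓) ∧ ∀ c ≠ 0, P (F' c) := by
  obtain ⟨e', F', hF', himm, h0, hinj, hadm, hE⟩ := hP (F 0) ⟨h𝓓 0, hexc⟩
  refine ⟨e', F', hF', h0, hinj, himm, hadm, fun c hc ↦ ?_⟩
  by_contra hPc
  exact hE c hc ⟨hadm c, hPc⟩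

/-- **Given `Q` tame-generic, tame genericity of `P` is EQUIVALENT to the exceptional-base hand-back
of `P`-curves along `Q`-curves** (`isTameChristodoulouGeneric_of_relative_exceptional` and
`exists_curve_of_isTameChristodoulouGeneric_of_not`): the relative form with exceptional base loses
nothing. [folklore] -/
theorem isTameChristodoulouGeneric_iff_relative_exceptional {𝓓 : Set (InitialDataSet (𝓡 3) X)}
    {Q P : InitialDataSet (𝓡 3) X → Prop}
    (h𝓓 : ∀ d ∈ 𝓓, ∃ e : AFEnd X, e.IsSoleEnd ∧ ∃ M : ℝ, e.IsStronglyAsymptoticallyFlatDR d M)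
    (hQ : IsTameChristodoulouGeneric 𝓓 Q 1) :
    IsTameChristodoulouGeneric 𝓓 P 1 ↔
      ∀ (e : AFEnd X) (F : EuclideanSpace ℝ (Fin 1) → InitialDataSet (𝓡 3) X),
        IsTameDataFamily e 1 F → ((IsImmersedAtZero 1 F ∧ Injective F) ∨ ∀ c, F c = F 0) →
          (∀ c, F c ∈ 𝓓) → (∀ c ≠ 0, Q (F c)) → ¬ P (F 0) →
            ∃ (e' : AFEnd X) (F' : EuclideanSpace ℝ (Fin 1) → InitialDataSet (𝓡 3) X),
              IsTameDataFamily e' 1 F' ∧ F' 0 = F 0 ∧ Injective F' ∧ IsImmersedAtZero 1 F' ∧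
                (∀ c, F' c ∈ 𝓓) ∧ ∀ c ≠ 0, P (F' c) :=
  ⟨fun hP e F hF hdich h𝓓F hQF hexc ↦
      exists_curve_of_isTameChristodoulouGeneric_of_not hP e F hF hdich h𝓓F hQF hexc,
    isTameChristodoulouGeneric_of_relative_exceptional h𝓓 hQ⟩

end InitialDataSet

end Literature.Geometry.Lorentzian

end
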